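import Summits.HodgeConjecture.HodgeConjecture.Theses.HeckePrymWeil
import Summits.HodgeConjecture.HodgeConjecture.Theorems.WeilTwelvefoldsSqrtMinus7.Negative.EigenvalueTyping
import Literature.AlgebraicGeometry.HodgeTheory.ComplexConjugation

/-!
# `WeilTwelvefoldsSqrtMinus7` (stmt-HodgeConjecture-1261) · Negative · the real structure of the typed Weil plane

Negative-side / tightness knowledge for the crux `HeckePrymWeil.WeilTwelvefoldsSqrtMinus7`, extracted from
the standing disprover's work file `Cruxes/WeilTwelvefoldsSqrtMinus7/Disproof.lean` §6
(refuter-cdisprove-stmt-HodgeConjecture-1261-g2-0, cycle 2, 2026-08-16); everything unconditional and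
valid for EVERY abelian variety `A` and EVERY endomorphism `ψ` (no dimension, no Weil relation).

The crux types the Weil plane as `Eig((𝟙+φ)^*, (1+i√7)^12) ⊔ Eig((𝟙+φ)^*, (1-i√7)^12)` inside
`H¹²(A(ℂ); ℂ)`.  The tree's complex conjugation `conjClass` on `Hᵏ(Y; ℂ)` (conjugation of the values of
singular cochains: natural `conjClass_map`, conjugate-linear `conjClass_smul`, involutive, and the
identity on rational classes `IsRationalClass.conjClass_eq` — `Literature/AlgebraicGeometry/HodgeTheory/
ComplexConjugation`) maps `Eig(g^*, μ)` to `Eig(g^*, conj μ)` for the pull-back along any continuous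
self-map; as `conj((1+i√7)^12) = (1-i√7)^12 ≠ (1+i√7)^12` (`weilEigenvalues_twelve_ne` of the companion
file `EigenvalueTyping`), it SWAPS the two typed eigenspaces.  Hence:

* `rational_mem_plusEigenspace_eq_zero`, `rational_mem_minusEigenspace_eq_zero`: a RATIONAL class in ONE
  typed eigenspace is `0`;
* `onlyPlusVariant_holds`, `onlyMinusVariant_holds` — REFUTED-AS-VACUOUS STRENGTHENINGS OF THE TYPING: the
  variants of the crux whose Weil-plane hypothesis keeps only one eigenspace are provable outright (every
  admissible class is `0`), so the `⊔` of both eigenspaces is essential to the meaning of the crux;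
* `weilComponents_conj`: the two components `c = c₊ + c₋` of a rational class of the typed plane are
  conjugate, `conj c₊ = c₋`; `weilComponent_rational_imp_zero`: if `c₊` is rational then `c = 0` — the crux
  can never be applied to a component separately;
* `components_mem_span_pair` (pure linear algebra): `c₊, c₋ ∈ span_ℂ {c, f c}` when `f c± = μ± c±`,
  `μ₊ ≠ μ₋` — the 2×2 inversion of `WeilDescending`'s recombination step.

For a refuter these constrain witnesses (a counterexample class has two conjugate, non-zero, non-rational
components); for a prover they are the splitting/recombination toolkit of the typed plane.
-/

noncomputable section

set_option linter.dupNamespace false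

open Complex CategoryTheory
open Literature.AlgebraicGeometry Literature.AlgebraicGeometry.HodgeTheory
open Literature.AlgebraicTopology.SingularHomology

namespace Summit.HodgeConjecture.HodgeConjecture.Theorems.WeilTwelvefoldsSqrtMinus7.Negative

/-! ## Generic: conjugation versus eigenspaces of a pull-back -/

section Generic

variable {Y : Type} [TopologicalSpace Y] {k : ℕ}

/-- **Conjugation maps `Eig(f^*, μ)` into `Eig(f^*, conj μ)`** for the pull-back along any continuous
self-map `f` of a space `Y` (naturality and conjugate-linearity of `conjClass`).
[cite: VoisinHodgeI2002, Cor. 6.12] -/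
theorem conjClass_mem_eigenspace_map (f : C(Y, Y)) {μ : ℂ} {c : singularCohomology ℂ ℂ Y k}
    (hc : c ∈ Module.End.eigenspace (singularCohomology.map ℂ ℂ f k).hom μ) :
    conjClass Y k c ∈ Module.End.eigenspace (singularCohomology.map ℂ ℂ f k).hom (starRingEnd ℂ μ) := by
  rw [Module.End.mem_eigenspace_iff] at hc ⊢
  have h := conjClass_map f (conjClass Y k c)
  rw [conjClass_conjClass] at h
  change (singularCohomology.map ℂ ℂ f k) (conjClass Y k c) = _
  have hc' : (singularCohomology.map ℂ ℂ f k) c = μ • c := hc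
  apply (conjClassEquiv Y k).injective
  simp only [conjClassEquiv_apply]
  rw [h, hc', conjClass_smul, conjClass_conjClass]
  simp

/-- Membership in two eigenspaces of one endomorphism with distinct eigenvalues forces `0`. [folklore] -/
theorem eq_zero_of_mem_eigenspace_of_mem_eigenspace {M : Type*} [AddCommGroup M] [Module ℂ M]
    (f : Module.End ℂ M) {μ ν : ℂ} (hμν : μ ≠ ν) {c : M}
    (hμ : c ∈ f.eigenspace μ) (hν : c ∈ f.eigenspace ν) : c = 0 := by
  rw [Module.End.mem_eigenspace_iff] at hμ hν
  have h : (μ - ν) • c = 0 := by rw [sub_smul, ← hμ, ← hν, sub_self]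
  exact (smul_eq_zero.1 h).resolve_left (sub_ne_zero.2 hμν)

/-- **A rational class in an eigenspace of a pull-back for a NON-REAL eigenvalue is zero**: `conj c = c`
lies in the `conj μ`-eigenspace as well. [cite: VoisinHodgeI2002, Cor. 6.12] -/
theorem eq_zero_of_isRationalClass_of_mem_eigenspace (f : C(Y, Y)) {μ : ℂ} (hμ : starRingEnd ℂ μ ≠ μ)
    {c : singularCohomology ℂ ℂ Y k} (hr : IsRationalClass c)
    (hc : c ∈ Module.End.eigenspace (singularCohomology.map ℂ ℂ f k).hom μ) : c = 0 := by
  have h := conjClass_mem_eigenspace_map f hc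
  rw [hr.conjClass_eq] at h
  exact eq_zero_of_mem_eigenspace_of_mem_eigenspace _ hμ h hc

/-- **2×2 inversion.** If `c = c_μ + c_ν` with `f c_μ = μ c_μ`, `f c_ν = ν c_ν` and `μ ≠ ν`, then both
components lie in `span_ℂ {c, f c}`: `c_μ = (f c - ν c)/(μ-ν)`, `c_ν = (μ c - f c)/(μ-ν)` (the linear
algebra of `WeilDescending`'s recombination, with `f = (𝟙+φ)^*`, `μ, ν = (1 ± i√7)^{2n}`). [folklore] -/
theorem components_mem_span_pair {M : Type*} [AddCommGroup M] [Module ℂ M]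
    (f : Module.End ℂ M) {μ ν : ℂ} (hμν : μ ≠ ν) {c cμ cν : M}
    (hμ : cμ ∈ f.eigenspace μ) (hν : cν ∈ f.eigenspace ν) (hc : c = cμ + cν) :
    cμ ∈ Submodule.span ℂ {c, f c} ∧ cν ∈ Submodule.span ℂ {c, f c} := by
  rw [Module.End.mem_eigenspace_iff] at hμ hν
  have hfc : f c = μ • cμ + ν • cν := by rw [hc, map_add, hμ, hν]
  have hd : μ - ν ≠ 0 := sub_ne_zero.2 hμν
  have hcmem : c ∈ Submodule.span ℂ {c, f c} := Submodule.subset_span (by simp)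
  have hfmem : f c ∈ Submodule.span ℂ {c, f c} := Submodule.subset_span (by simp)
  constructor
  · have key : (μ - ν) • cμ = f c - ν • c := by
      rw [hfc, hc, sub_smul, smul_add]; abel
    have : cμ = (μ - ν)⁻¹ • (f c - ν • c) := by
      rw [← key, smul_smul, inv_mul_cancel₀ hd, one_smul]
    rw [this]
    exact Submodule.smul_mem _ _ (Submodule.sub_mem _ hfmem (Submodule.smul_mem _ _ hcmem))
  · have key : (μ - ν) • cν = μ • c - f c := by
      rw [hfc, hc, sub_smul, smul_add]; abel
    have : cν = (μ - ν)⁻¹ • (μ • c - f c) := by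
      rw [← key, smul_smul, inv_mul_cancel₀ hd, one_smul]
    rw [this]
    exact Submodule.smul_mem _ _ (Submodule.sub_mem _ (Submodule.smul_mem _ _ hcmem) hfmem)

end Generic

/-! ## The conjugate of the typed eigenvalue -/

/-- `conj √7 = √7` in `ℂ`. [folklore] -/
theorem conj_sqrt7 : starRingEnd ℂ ((Real.sqrt (7 : ℝ) : ℝ) : ℂ) = ((Real.sqrt (7 : ℝ) : ℝ) : ℂ) :=
  Complex.conj_ofReal _

/-- `conj((1+i√7)^n) = (1-i√7)^n`. [folklore] -/
theorem conj_one_add_I_sqrt7_pow (n : ℕ) :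
    starRingEnd ℂ ((1 + I * ((Real.sqrt (7 : ℝ) : ℝ) : ℂ)) ^ n) = (1 - I * ((Real.sqrt (7 : ℝ) : ℝ) : ℂ)) ^ n := by
  rw [map_pow, map_add, map_one, map_mul, Complex.conj_I, conj_sqrt7]
  ring

/-- `conj((1-i√7)^n) = (1+i√7)^n`. [folklore] -/
theorem conj_one_sub_I_sqrt7_pow (n : ℕ) :
    starRingEnd ℂ ((1 - I * ((Real.sqrt (7 : ℝ) : ℝ) : ℂ)) ^ n) = (1 + I * ((Real.sqrt (7 : ℝ) : ℝ) : ℂ)) ^ n := by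
  rw [map_pow, map_sub, map_one, map_mul, Complex.conj_I, conj_sqrt7]
  ring

/-- The typed eigenvalue `(1+i√7)^12` is not real: its conjugate is the OTHER typed eigenvalue. [folklore] -/
theorem conj_weilEigenvalue_twelve_ne :
    starRingEnd ℂ ((1 + I * ((Real.sqrt (7 : ℝ) : ℝ) : ℂ)) ^ 12) ≠ (1 + I * ((Real.sqrt (7 : ℝ) : ℝ) : ℂ)) ^ 12 := by
  rw [conj_one_add_I_sqrt7_pow]
  exact weilEigenvalues_twelve_ne.symm

/-- Mirror: `conj((1-i√7)^12) ≠ (1-i√7)^12`. [folklore] -/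
theorem conj_weilEigenvalueBar_twelve_ne :
    starRingEnd ℂ ((1 - I * ((Real.sqrt (7 : ℝ) : ℝ) : ℂ)) ^ 12) ≠ (1 - I * ((Real.sqrt (7 : ℝ) : ℝ) : ℂ)) ^ 12 := by
  rw [conj_one_sub_I_sqrt7_pow]
  exact weilEigenvalues_twelve_ne

/-! ## Crux level: the typed Weil plane of `(A, ψ)` in `H¹²(A(ℂ); ℂ)` -/

section Crux

variable (A : Motives.AbelianVariety ℂ) (ψ : A ⟶ A)

/-- **A rational class in the `+` typed eigenspace ALONE is zero** — for every abelian variety `A` and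
every endomorphism `ψ`. [cite: VoisinHodgeI2002, Cor. 6.12] -/
theorem rational_mem_plusEigenspace_eq_zero {c : complexBetti A.X 12} (hr : IsRationalClass c)
    (hc : c ∈ Module.End.eigenspace (complexBetti.map ψ.hom.hom.hom 12).hom
      ((1 + I * ((Real.sqrt (7 : ℝ) : ℝ) : ℂ)) ^ 12)) : c = 0 :=
  eq_zero_of_isRationalClass_of_mem_eigenspace _ conj_weilEigenvalue_twelve_ne hr hc

/-- Mirror: a rational class in the `-` typed eigenspace alone is zero. [cite: VoisinHodgeI2002, Cor. 6.12] -/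
theorem rational_mem_minusEigenspace_eq_zero {c : complexBetti A.X 12} (hr : IsRationalClass c)
    (hc : c ∈ Module.End.eigenspace (complexBetti.map ψ.hom.hom.hom 12).hom
      ((1 - I * ((Real.sqrt (7 : ℝ) : ℝ) : ℂ)) ^ 12)) : c = 0 :=
  eq_zero_of_isRationalClass_of_mem_eigenspace _ conj_weilEigenvalueBar_twelve_ne hr hc

/-- **Refuted-as-vacuous strengthening of the typing (`+` only).**  The variant of the crux
`WeilTwelvefoldsSqrtMinus7` whose Weil-plane hypothesis is `c ∈ Eig((𝟙+φ)^*, (1+i√7)^12)` alone holds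
outright: every admissible class is `0 ∈ algebraicClasses`.  A statement typed this way is trivially
true; the `⊔` of both eigenspaces is essential. [folklore] -/
theorem onlyPlusVariant_holds :
    ∀ (A : Motives.AbelianVariety ℂ) (φ : A ⟶ A), A.dim = 12 →
      CategoryStruct.comp φ φ = -((7 : ℤ) • CategoryStruct.id A) →
      ∀ c : complexBetti A.X 12, IsRationalClass c → IsOfHodgeType 12 A.X 12 6 6 c →
        c ∈ Module.End.eigenspace (complexBetti.map (CategoryStruct.id A + φ).hom.hom.hom 12).hom
              ((1 + Complex.I * (Real.sqrt (7 : ℝ) : ℂ)) ^ 12) →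
        c ∈ algebraicClasses A.X 6 := by
  intro A φ _ _ c hr _ hc
  rw [rational_mem_plusEigenspace_eq_zero A _ hr hc]
  exact Submodule.zero_mem _

/-- **Refuted-as-vacuous strengthening of the typing (`-` only).** [folklore] -/
theorem onlyMinusVariant_holds :
    ∀ (A : Motives.AbelianVariety ℂ) (φ : A ⟶ A), A.dim = 12 →
      CategoryStruct.comp φ φ = -((7 : ℤ) • CategoryStruct.id A) →
      ∀ c : complexBetti A.X 12, IsRationalClass c → IsOfHodgeType 12 A.X 12 6 6 c →
        c ∈ Module.End.eigenspace (complexBetti.map (CategoryStruct.id A + φ).hom.hom.hom 12).hom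
              ((1 - Complex.I * (Real.sqrt (7 : ℝ) : ℂ)) ^ 12) →
        c ∈ algebraicClasses A.X 6 := by
  intro A φ _ _ c hr _ hc
  rw [rational_mem_minusEigenspace_eq_zero A _ hr hc]
  exact Submodule.zero_mem _

/-- **The Weil components of a rational class are conjugate**: if `c = c₊ + c₋` is rational with
`c± ∈ Eig(ψ^*, (1 ± i√7)^12)` then `conj c₊ = c₋`. [cite: VoisinHodgeI2002, Cor. 6.12] -/
theorem weilComponents_conj {c cp cm : complexBetti A.X 12} (hr : IsRationalClass c)
    (hp : cp ∈ Module.End.eigenspace (complexBetti.map ψ.hom.hom.hom 12).hom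
      ((1 + I * ((Real.sqrt (7 : ℝ) : ℝ) : ℂ)) ^ 12))
    (hm : cm ∈ Module.End.eigenspace (complexBetti.map ψ.hom.hom.hom 12).hom
      ((1 - I * ((Real.sqrt (7 : ℝ) : ℝ) : ℂ)) ^ 12))
    (hc : c = cp + cm) : conjClass _ 12 cp = cm := by
  have hp' := conjClass_mem_eigenspace_map _ hp
  have hm' := conjClass_mem_eigenspace_map _ hm
  rw [conj_one_add_I_sqrt7_pow] at hp'
  rw [conj_one_sub_I_sqrt7_pow] at hm'
  have hcc : conjClass _ 12 cp + conjClass _ 12 cm = cp + cm := by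
    rw [← conjClass_add, ← hc, hr.conjClass_eq]
  have hd1 : conjClass _ 12 cp - cm ∈ Module.End.eigenspace (complexBetti.map ψ.hom.hom.hom 12).hom
      ((1 - I * ((Real.sqrt (7 : ℝ) : ℝ) : ℂ)) ^ 12) := Submodule.sub_mem _ hp' hm
  have heq : conjClass _ 12 cp - cm = cp - conjClass _ 12 cm := by
    rw [sub_eq_sub_iff_add_eq_add, hcc]
  have hd2 : conjClass _ 12 cp - cm ∈ Module.End.eigenspace (complexBetti.map ψ.hom.hom.hom 12).hom
      ((1 + I * ((Real.sqrt (7 : ℝ) : ℝ) : ℂ)) ^ 12) := by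
    rw [heq]; exact Submodule.sub_mem _ hp hm'
  exact sub_eq_zero.1 (eq_zero_of_mem_eigenspace_of_mem_eigenspace _ weilEigenvalues_twelve_ne hd2 hd1)

/-- **Refuted strengthening: rational components.**  If the `+` component of a rational class of the
typed plane is itself rational, the class is `0`. [folklore] -/
theorem weilComponent_rational_imp_zero {c cp cm : complexBetti A.X 12} (hr : IsRationalClass c)
    (hp : cp ∈ Module.End.eigenspace (complexBetti.map ψ.hom.hom.hom 12).hom
      ((1 + I * ((Real.sqrt (7 : ℝ) : ℝ) : ℂ)) ^ 12))
    (hm : cm ∈ Module.End.eigenspace (complexBetti.map ψ.hom.hom.hom 12).hom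
      ((1 - I * ((Real.sqrt (7 : ℝ) : ℝ) : ℂ)) ^ 12))
    (hc : c = cp + cm) (hpr : IsRationalClass cp) : c = 0 := by
  have h0 : cp = 0 := rational_mem_plusEigenspace_eq_zero A ψ hpr hp
  have h1 := weilComponents_conj A ψ hr hp hm hc
  rw [h0, conjClass_zero] at h1
  rw [hc, h0, ← h1, add_zero]

end Crux

end Summit.HodgeConjecture.HodgeConjecture.Theorems.WeilTwelvefoldsSqrtMinus7.Negative

end
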